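import Summits.ValiantsHypothesis.ValiantsHypothesis.Theorems.LacunarySymmetroidMatrixDescartesCensusV20Check

/-!
# `MatrixDescartes` census — semantics of the `V = 20` certificate checker (definitions)

HONEST FRAMING.  Object-search cell `pub-symmetroid`; door-A item `DoorA26 = PosRootLawAt 2 6 19`
(stmt-ValiantsHypothesis-19979; OPEN, typed, never asserted).  DEFINITIONS ONLY: the real-valued semantics of the
objects manipulated by the checker of `…CensusV20Check` — values of terms and polynomials under an atom valuation,
monomials of absolute values, factored rationals, what it means for a row to hold, and the `Model` (everything a
hypothetical twenty of a given orientation supplies: positive absolute values at the 21 positions, the signed atom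
valuation, the Newton-cone rows, the Gram inequalities `G3, RCS, W ≥ 0`, no odd definite triangle), together with the
entry-level atoms `qv`/`bv`/`aval` of six real symmetric `2 × 2` letters and the pencil determinant `pdet`.  The proofs
(`…CensusV20Sound*`) show that a model refutes every accepted certificate and that a twenty yields a model.  Nothing here
bears on `V = 19`, on `ζ_sym(2,6)` over all supports, on `MatrixDescartes` (stmt-ValiantsHypothesis-18050) or on `VP ≠ VNP`.

[folklore] Bookkeeping; elementary.
-/

-- the D-0017 layout repeats a namespace component (single-conjunct summit); the `dupNamespace` linter flags it; name mandated.
set_option linter.dupNamespace false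

namespace Summit.ValiantsHypothesis.ValiantsHypothesis.Theorems.LacunarySymmetroidMatrixDescartes.Census.V20

open Polynomial

/-! ## Values of terms, polynomials, monomials -/

/-- Real sign attached to a position. [folklore] -/
noncomputable def sgnR (s : Bool) (t : ℕ) : ℝ := if negAt s t then -1 else 1

/-- Value of a term under an atom valuation. [folklore] -/
noncomputable def tval (v : Atom → ℝ) (T : Term) : ℝ := (T.1 : ℝ) * (T.2.map v).prod

/-- Value of a polynomial (term list). [folklore] -/
noncomputable def pval (v : Atom → ℝ) (P : List Term) : ℝ := (P.map (tval v)).sum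

/-- Product of the values `x p` over a list of positions. [folklore] -/
noncomputable def lprod (x : ℕ → ℝ) (ps : List ℕ) : ℝ := (ps.map x).prod

/-! ## Count vectors and factored rationals -/

/-- `∏_{t} x (t₀ + t) ^ V_t`. [folklore] -/
noncomputable def xpowAux (x : ℕ → ℝ) : List ℕ → ℕ → ℝ
  | [], _ => 1
  | e :: V, t => x t ^ e * xpowAux x V (t + 1)

/-- `∏_{t < |V|} x t ^ V_t`. [folklore] -/
noncomputable def xpow (x : ℕ → ℝ) (V : List ℕ) : ℝ := xpowAux x V 0

/-- Real value of a factored rational. [folklore] -/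
noncomputable def frval (A : FRat) : ℝ := (A.map fun bz => (bz.1 : ℝ) ^ bz.2).prod

/-- All bases positive. [folklore] -/
def BPos (A : FRat) : Prop := ∀ bz ∈ A, 0 < bz.1

/-! ## Rows and the model -/

/-- What a hypothetical twenty of orientation `s` on the support `dl` (order `ord`) supplies: absolute values
`x`, a signed atom valuation `v`, the Newton-cone rows and the Gram inequalities. [folklore] -/
structure Model (dl : List ℕ) (ord : List Atom) (s : Bool) (x : ℕ → ℝ) (v : Atom → ℝ) : Prop where
  /-- the order passed the check -/
  hord : ordOK dl ord = true
  /-- absolute values are positive -/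
  xpos : ∀ t, 0 < x t
  /-- atoms evaluate to signed absolute values -/
  hv : ∀ a ∈ allAtoms, v a = sgnR s (posOf a ord) * x (posOf a ord)
  /-- Newton-cone rows -/
  c25 : ∀ t, 1 ≤ t → t ≤ 19 →
    lprod x (rowC25 (sums dl ord) t).L * (fval (rowC25 (sums dl ord) t).Bden : ℝ)
      ≤ lprod x (rowC25 (sums dl ord) t).R * (fval (rowC25 (sums dl ord) t).Bnum : ℝ)
  /-- `G3 ≥ 0` -/
  g3 : ∀ i j k, i < j → j < k → k < 6 → 0 ≤ pval v (G3poly i j k)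
  /-- `RCS ≥ 0` for a definite first letter -/
  rcs : ∀ i j, i < 6 → j < 6 → i ≠ j → 0 < v (qA i) → 0 ≤ pval v (RCSpoly i j)
  /-- `W ≥ 0` -/
  w : ∀ i j k l, i < 6 → j < 6 → k < 6 → l < 6 → i ≠ j → i ≠ k → i ≠ l → j ≠ k → j ≠ l → k < l →
    0 ≤ pval v (Wpoly i j k l)
  /-- no odd definite triangle -/
  tri : ∀ i j k, i < j → j < k → k < 6 → 0 < v (qA i) → 0 < v (qA j) → 0 < v (qA k) →
    0 < v (cA i j) * v (cA j k) * v (cA i k)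

/-- A row holds for the absolute values `x`. [folklore] -/
def Row.Holds (x : ℕ → ℝ) (r : Row) : Prop :=
  lprod x r.L * (fval r.Bden : ℝ) ≤ lprod x r.R * (fval r.Bnum : ℝ)

/-- Every position of the row is one of the 21, and all constant bases are positive. [folklore] -/
def Row.WF (r : Row) : Prop :=
  (∀ p ∈ r.L, p < 21) ∧ (∀ p ∈ r.R, p < 21) ∧ (∀ be ∈ r.Bnum, 0 < be.1) ∧ (∀ be ∈ r.Bden, 0 < be.1)

/-! ## Six letters: atoms in entries, the pencil determinant -/

/-- The exponent vector of a support given as a list. [folklore] -/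
def dfun (dl : List ℕ) : Fin 6 → ℕ := fun i => dl.getD i 0

/-- Letter index as an element of `Fin 6`. [folklore] -/
def fin6 (i : ℕ) : Fin 6 := ⟨i % 6, Nat.mod_lt _ (by norm_num)⟩

/-- `q i = det S i` in entries. [folklore] -/
def qv (S : Fin 6 → Matrix (Fin 2) (Fin 2) ℝ) (i : ℕ) : ℝ :=
  S (fin6 i) 0 0 * S (fin6 i) 1 1 - S (fin6 i) 0 1 ^ 2

/-- `β i j = 2·B(S i, S j)` in entries. [folklore] -/
def bv (S : Fin 6 → Matrix (Fin 2) (Fin 2) ℝ) (i j : ℕ) : ℝ :=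
  S (fin6 i) 0 0 * S (fin6 j) 1 1 + S (fin6 i) 1 1 * S (fin6 j) 0 0 - 2 * (S (fin6 i) 0 1 * S (fin6 j) 0 1)

/-- The atom valuation of six letters. [folklore] -/
def aval (S : Fin 6 → Matrix (Fin 2) (Fin 2) ℝ) (a : Atom) : ℝ := if a.1 = a.2 then qv S a.1 else bv S a.1 a.2

/-- Pair sum at position `t` of the order. [folklore] -/
def Epos (dl : List ℕ) (ord : List Atom) (t : ℕ) : ℕ := psum dl (ord.getD t (0, 0))

/-- The pencil determinant on the support `dl`. [folklore] -/
noncomputable def pdet (dl : List ℕ) (S : Fin 6 → Matrix (Fin 2) (Fin 2) ℝ) : ℝ[X] :=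
  Matrix.det (∑ l, ((X : ℝ[X]) ^ dfun dl l) • (S l).map C)

end Summit.ValiantsHypothesis.ValiantsHypothesis.Theorems.LacunarySymmetroidMatrixDescartes.Census.V20
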